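import Summits.MatrixMultiplication.MatrixMultiplication.Theorems.SoloInformedValThreeBlockBudget

/-!
# Tournament packing inequalities and the normalised bound `T³ ≤ |G|²·|I|·|J|·|K|` for three blocks

Solo-informed MatrixMultiplication, gen 83 (dossier `paper/val-superlinear.md` §15.8 (n)(xviii); CLAIMS c604–c605);
a sequel to `SoloInformedValTwoBlockU2N` / `SoloInformedValTwoBlockU2NOverlap`, whose two-block machinery
(`mixedImage`, `NoAccidental.disjoint_mixedImage_111_122`, `NoAccidental.card_mixedImage_block`,
`NoAccidental.swap_blocks`) is reused throughout; the real algebra (quadratic budget, three-term Hölder, the numeric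
criterion `cube_le_of_overlaps₃`) is in `SoloInformedValThreeBlockBudget`.

SETTING.  Three complete blocks `X_t × Y_t × Z_t` (`t = 1, 2, 3`; identity potentials in a finite abelian group
`G`; pair graphs `blockPairs₃`, the union of the three boxes of pairs) with PAIRWISE DISJOINT column classes
`Y_t`; rows and `K`-classes are arbitrary.  Write `v_t = |X_t||Y_t||Z_t|`, `w_t = |Y_t||Z_t|`, `n = |G|`,
`O_tu = |X_t ∩ X_u|`, `c = |X₁ ∩ X₂ ∩ X₃|`.

THE TRANSITIVE SINK INEQUALITY (`NoAccidental.sink_ineq`).  For every ordering `(s, u, t)` of the blocks,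

  `v_t + O_ut · w_u + c · w_s ≤ n`.

The three sets `X_t + Y_t - Z_t`, `(X_u ∩ X_t) + Y_u - Z_u`, `(X_s ∩ X_u ∩ X_t) + Y_s - Z_s` are uniquely
represented (sub-boxes of TPP blocks) and pairwise disjoint: a coincidence between the pieces of blocks `a → b`
(the rows of `a`'s piece lie in `X_b`) is the accidental solution `(x' - y_a) + (y_b - z_b) + (z_a - x) = 0` and
would force `y_a = y_b`.  This is the transitive-tournament case of the general TOURNAMENT INEQUALITY
`Σ_t |⋂_{u ∈ N⁺[t]} X_u| · w_t ≤ n` (one for every tournament on the blocks; for two blocks these are the two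
overlap inequalities of `SoloInformedValTwoBlockU2N`); only the six transitive instances are needed below, and they
are obtained from the two-block lemmas applied to the three two-block sub-unions.

THE THEOREM (`NoAccidental.card_triangleSet₃_pow_three_le`).  If moreover the `K`-classes `Z_t` are pairwise
disjoint, the number `T = v₁ + v₂ + v₃` of supported triangles satisfies

  `T³ ≤ n² · |X₁ ∪ X₂ ∪ X₃| · |Y₁ ∪ Y₂ ∪ Y₃| · |Z₁ ∪ Z₂ ∪ Z₃|`.

The deduction (`SoloInformedValThreeBlockBudget.cube_le_of_overlaps₃`) is the QUADRATIC BUDGET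
`Σ_t |X_t| v_t² ≤ n² (|X₁| + |X₂| + |X₃| + c - O₁₂ - O₁₃ - O₂₃) = n² |X₁ ∪ X₂ ∪ X₃|` (a positive polynomial
identity in the six sink inequalities) followed by the three-term Hölder inequality with `a_t = |X_t| v_t²`,
`b_t = |Y_t|`, `c_t = |Z_t|`; here we supply the sink inequalities, the triangle count `T = v₁ + v₂ + v₃`
(`card_triangleSet_blockPairs₃`) and the inclusion–exclusion bookkeeping for the rows.  The corresponding LINEAR
budget `Σ_t |X_t| v_t ≤ n |X₁ ∪ X₂ ∪ X₃|` does NOT follow from the tournament inequalities for three blocks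
(relaxation value `4/3` at the triangle design `X₁ = A ⊔ B`, `X₂ = A ⊔ C`, `X₃ = B ⊔ C`), and for four or more
blocks the tournament inequalities do not imply the normalised bound at all (the `K₄`-pairs design has ratio `9/8`):
the three-block theorem is the limit of the pairwise packing method.  No `sorry`.
-/

namespace Summit.MatrixMultiplication.MatrixMultiplication.Theorems.SoloVal

open Finset

section ThreeBlocks

variable {G : Type*} [AddCommGroup G] [DecidableEq G]

/-- The pair graph `A₁ × B₁ ∪ A₂ × B₂ ∪ A₃ × B₃` of a union of three complete blocks. -/
def blockPairs₃ (A₁ B₁ A₂ B₂ A₃ B₃ : Finset G) : Finset (G × G) := blockPairs A₁ B₁ A₂ B₂ ∪ A₃ ×ˢ B₃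

omit [AddCommGroup G] in
/-- Membership in `blockPairs₃`. -/
theorem mem_blockPairs₃ {A₁ B₁ A₂ B₂ A₃ B₃ : Finset G} {u v : G} :
    (u, v) ∈ blockPairs₃ A₁ B₁ A₂ B₂ A₃ B₃ ↔
      (u ∈ A₁ ∧ v ∈ B₁) ∨ (u ∈ A₂ ∧ v ∈ B₂) ∨ (u ∈ A₃ ∧ v ∈ B₃) := by
  unfold blockPairs₃
  rw [Finset.mem_union, mem_blockPairs, Finset.mem_product, or_assoc]

omit [AddCommGroup G] in
/-- The sub-union of blocks 1 and 2. -/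
theorem blockPairs_subset_blockPairs₃_left {A₁ B₁ A₂ B₂ A₃ B₃ : Finset G} :
    blockPairs A₁ B₁ A₂ B₂ ⊆ blockPairs₃ A₁ B₁ A₂ B₂ A₃ B₃ :=
  Finset.subset_union_left

omit [AddCommGroup G] in
/-- The sub-union of blocks 1 and 3. -/
theorem blockPairs_subset_blockPairs₃_outer {A₁ B₁ A₂ B₂ A₃ B₃ : Finset G} :
    blockPairs A₁ B₁ A₃ B₃ ⊆ blockPairs₃ A₁ B₁ A₂ B₂ A₃ B₃ := by
  rintro ⟨u, v⟩ h
  rw [mem_blockPairs] at h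
  rw [mem_blockPairs₃]
  tauto

omit [AddCommGroup G] in
/-- The sub-union of blocks 2 and 3. -/
theorem blockPairs_subset_blockPairs₃_right {A₁ B₁ A₂ B₂ A₃ B₃ : Finset G} :
    blockPairs A₂ B₂ A₃ B₃ ⊆ blockPairs₃ A₁ B₁ A₂ B₂ A₃ B₃ := by
  rintro ⟨u, v⟩ h
  rw [mem_blockPairs] at h
  rw [mem_blockPairs₃]
  tauto

variable {X₁ Y₁ Z₁ X₂ Y₂ Z₂ X₃ Y₃ Z₃ : Finset G}

omit [AddCommGroup G] in
/-- `blockPairs` is monotone in the first class. -/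
theorem blockPairs_mono₁ {A A' B C D : Finset G} (h : A' ⊆ A) : blockPairs A' B C D ⊆ blockPairs A B C D := by
  rintro ⟨u, v⟩ huv
  rw [mem_blockPairs] at huv ⊢
  exact huv.imp (fun h1 => ⟨h h1.1, h1.2⟩) id

omit [AddCommGroup G] in
/-- `blockPairs` is monotone in the second class. -/
theorem blockPairs_mono₂ {A B B' C D : Finset G} (h : B' ⊆ B) : blockPairs A B' C D ⊆ blockPairs A B C D := by
  rintro ⟨u, v⟩ huv
  rw [mem_blockPairs] at huv ⊢
  exact huv.imp (fun h1 => ⟨h1.1, h h1.2⟩) id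

/-- Shrinking the row class of block 1 preserves accidental-freeness of a two-block union. -/
theorem NoAccidental.subblock {X' : Finset G} (hX : X' ⊆ X₁)
    (hN : NoAccidental (id : G → G) id id (blockPairs X₁ Y₁ X₂ Y₂) (blockPairs Y₁ Z₁ Y₂ Z₂)
      (blockPairs Z₁ X₁ Z₂ X₂)) :
    NoAccidental (id : G → G) id id (blockPairs X' Y₁ X₂ Y₂) (blockPairs Y₁ Z₁ Y₂ Z₂)
      (blockPairs Z₁ X' Z₂ X₂) :=
  fun i j j' k k' i' hij hjk hki => hN i j j' k k' i' (blockPairs_mono₁ hX hij) hjk (blockPairs_mono₂ hX hki)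

/-- Blocks 1, 2 of an accidental-free three-block union form an accidental-free two-block union. -/
theorem NoAccidental.sub₁₂
    (hN : NoAccidental (id : G → G) id id (blockPairs₃ X₁ Y₁ X₂ Y₂ X₃ Y₃) (blockPairs₃ Y₁ Z₁ Y₂ Z₂ Y₃ Z₃)
      (blockPairs₃ Z₁ X₁ Z₂ X₂ Z₃ X₃)) :
    NoAccidental (id : G → G) id id (blockPairs X₁ Y₁ X₂ Y₂) (blockPairs Y₁ Z₁ Y₂ Z₂)
      (blockPairs Z₁ X₁ Z₂ X₂) :=
  fun i j j' k k' i' hij hjk hki => hN i j j' k k' i' (blockPairs_subset_blockPairs₃_left hij)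
    (blockPairs_subset_blockPairs₃_left hjk) (blockPairs_subset_blockPairs₃_left hki)

/-- Blocks 1, 3 of an accidental-free three-block union form an accidental-free two-block union. -/
theorem NoAccidental.sub₁₃
    (hN : NoAccidental (id : G → G) id id (blockPairs₃ X₁ Y₁ X₂ Y₂ X₃ Y₃) (blockPairs₃ Y₁ Z₁ Y₂ Z₂ Y₃ Z₃)
      (blockPairs₃ Z₁ X₁ Z₂ X₂ Z₃ X₃)) :
    NoAccidental (id : G → G) id id (blockPairs X₁ Y₁ X₃ Y₃) (blockPairs Y₁ Z₁ Y₃ Z₃)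
      (blockPairs Z₁ X₁ Z₃ X₃) :=
  fun i j j' k k' i' hij hjk hki => hN i j j' k k' i' (blockPairs_subset_blockPairs₃_outer hij)
    (blockPairs_subset_blockPairs₃_outer hjk) (blockPairs_subset_blockPairs₃_outer hki)

/-- Blocks 2, 3 of an accidental-free three-block union form an accidental-free two-block union. -/
theorem NoAccidental.sub₂₃
    (hN : NoAccidental (id : G → G) id id (blockPairs₃ X₁ Y₁ X₂ Y₂ X₃ Y₃) (blockPairs₃ Y₁ Z₁ Y₂ Z₂ Y₃ Z₃)
      (blockPairs₃ Z₁ X₁ Z₂ X₂ Z₃ X₃)) :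
    NoAccidental (id : G → G) id id (blockPairs X₂ Y₂ X₃ Y₃) (blockPairs Y₂ Z₂ Y₃ Z₃)
      (blockPairs Z₂ X₂ Z₃ X₃) :=
  fun i j j' k k' i' hij hjk hki => hN i j j' k k' i' (blockPairs_subset_blockPairs₃_right hij)
    (blockPairs_subset_blockPairs₃_right hjk) (blockPairs_subset_blockPairs₃_right hki)

/-- THE TRANSITIVE SINK INEQUALITY `v_t + |ρ_u||Y_u||Z_u| + |ρ_s||Y_s||Z_s| ≤ |G|` for three blocks `t, u, s`
whose two-block sub-unions are accidental-free, with pairwise disjoint `Y`-classes, `ρ_u ⊆ X_u ∩ X_t` and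
`ρ_s ⊆ X_s ∩ X_u ∩ X_t`: the pieces `X_t + Y_t - Z_t`, `ρ_u + Y_u - Z_u`, `ρ_s + Y_s - Z_s` are uniquely
represented and pairwise disjoint (each disjointness is `NoAccidental.disjoint_mixedImage_111_122` for the
sub-union of the two blocks concerned, the rows of the dominating piece lying in the other block's row class). -/
theorem NoAccidental.sink_ineq [Fintype G] {Xt Yt Zt Xu Yu Zu Xs Ys Zs ρu ρs : Finset G}
    (hNtu : NoAccidental (id : G → G) id id (blockPairs Xt Yt Xu Yu) (blockPairs Yt Zt Yu Zu)
      (blockPairs Zt Xt Zu Xu))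
    (hNts : NoAccidental (id : G → G) id id (blockPairs Xt Yt Xs Ys) (blockPairs Yt Zt Ys Zs)
      (blockPairs Zt Xt Zs Xs))
    (hNus : NoAccidental (id : G → G) id id (blockPairs Xu Yu Xs Ys) (blockPairs Yu Zu Ys Zs)
      (blockPairs Zu Xu Zs Xs))
    (hYtu : Disjoint Yt Yu) (hYts : Disjoint Yt Ys) (hYus : Disjoint Yu Ys) (hρut : ρu ⊆ Xt)
    (hρuu : ρu ⊆ Xu) (hρst : ρs ⊆ Xt) (hρsu : ρs ⊆ Xu) (hρss : ρs ⊆ Xs) :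
    Xt.card * Yt.card * Zt.card + ρu.card * Yu.card * Zu.card + ρs.card * Ys.card * Zs.card
      ≤ Fintype.card G := by
  have ct : (mixedImage Xt Yt Zt).card = Xt.card * Yt.card * Zt.card := hNtu.card_mixedImage_block
  have cu : (mixedImage ρu Yu Zu).card = ρu.card * Yu.card * Zu.card :=
    (hNtu.swap_blocks.subblock hρuu).card_mixedImage_block
  have cs : (mixedImage ρs Ys Zs).card = ρs.card * Ys.card * Zs.card :=
    (hNus.swap_blocks.subblock hρss).card_mixedImage_block
  have dtu : Disjoint (mixedImage Xt Yt Zt) (mixedImage ρu Yu Zu) :=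
    (hNtu.disjoint_mixedImage_111_122 hYtu).mono_right (mixedImage_mono hρut)
  have dts : Disjoint (mixedImage Xt Yt Zt) (mixedImage ρs Ys Zs) :=
    (hNts.disjoint_mixedImage_111_122 hYts).mono_right (mixedImage_mono hρst)
  have dus : Disjoint (mixedImage ρu Yu Zu) (mixedImage ρs Ys Zs) :=
    (hNus.disjoint_mixedImage_111_122 hYus).mono (mixedImage_mono hρuu) (mixedImage_mono hρsu)
  rw [← ct, ← cu, ← cs, ← Finset.card_union_of_disjoint dtu,
    ← Finset.card_union_of_disjoint (Finset.disjoint_union_left.mpr ⟨dts, dus⟩)]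
  exact Finset.card_le_univ _

omit [AddCommGroup G] in
/-- With pairwise disjoint `Y`-classes the triangles of a three-block union are exactly the three boxes (a
triangle's `IJ`- and `JK`-edges share their `J`-vertex, hence their block). -/
theorem triangleSet_blockPairs₃_eq (hY₁₂ : Disjoint Y₁ Y₂) (hY₁₃ : Disjoint Y₁ Y₃) (hY₂₃ : Disjoint Y₂ Y₃) :
    triangleSet (blockPairs₃ X₁ Y₁ X₂ Y₂ X₃ Y₃) (blockPairs₃ Y₁ Z₁ Y₂ Z₂ Y₃ Z₃)
        (blockPairs₃ Z₁ X₁ Z₂ X₂ Z₃ X₃) = X₁ ×ˢ Y₁ ×ˢ Z₁ ∪ X₂ ×ˢ Y₂ ×ˢ Z₂ ∪ X₃ ×ˢ Y₃ ×ˢ Z₃ := by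
  ext ⟨i, j, k⟩
  rw [mem_triangleSet, IsTriangle, mem_blockPairs₃, mem_blockPairs₃, mem_blockPairs₃, Finset.mem_union,
    Finset.mem_union, Finset.mem_product, Finset.mem_product, Finset.mem_product, Finset.mem_product,
    Finset.mem_product, Finset.mem_product]
  simp only
  constructor
  · rintro ⟨⟨hi, hj⟩ | ⟨hi, hj⟩ | ⟨hi, hj⟩, ⟨hj', hk⟩ | ⟨hj', hk⟩ | ⟨hj', hk⟩, -⟩
    · exact Or.inl (Or.inl ⟨hi, hj, hk⟩)
    · exact absurd hj' (Finset.disjoint_left.mp hY₁₂ hj)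
    · exact absurd hj' (Finset.disjoint_left.mp hY₁₃ hj)
    · exact absurd hj (Finset.disjoint_left.mp hY₁₂ hj')
    · exact Or.inl (Or.inr ⟨hi, hj, hk⟩)
    · exact absurd hj' (Finset.disjoint_left.mp hY₂₃ hj)
    · exact absurd hj (Finset.disjoint_left.mp hY₁₃ hj')
    · exact absurd hj (Finset.disjoint_left.mp hY₂₃ hj')
    · exact Or.inr ⟨hi, hj, hk⟩
  · rintro ((⟨hi, hj, hk⟩ | ⟨hi, hj, hk⟩) | ⟨hi, hj, hk⟩)
    · exact ⟨Or.inl ⟨hi, hj⟩, Or.inl ⟨hj, hk⟩, Or.inl ⟨hk, hi⟩⟩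
    · exact ⟨Or.inr (Or.inl ⟨hi, hj⟩), Or.inr (Or.inl ⟨hj, hk⟩), Or.inr (Or.inl ⟨hk, hi⟩)⟩
    · exact ⟨Or.inr (Or.inr ⟨hi, hj⟩), Or.inr (Or.inr ⟨hj, hk⟩), Or.inr (Or.inr ⟨hk, hi⟩)⟩

omit [AddCommGroup G] in
/-- With pairwise disjoint `Y`-classes: `T = v₁ + v₂ + v₃`. -/
theorem card_triangleSet_blockPairs₃ (hY₁₂ : Disjoint Y₁ Y₂) (hY₁₃ : Disjoint Y₁ Y₃)
    (hY₂₃ : Disjoint Y₂ Y₃) :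
    (triangleSet (blockPairs₃ X₁ Y₁ X₂ Y₂ X₃ Y₃) (blockPairs₃ Y₁ Z₁ Y₂ Z₂ Y₃ Z₃)
        (blockPairs₃ Z₁ X₁ Z₂ X₂ Z₃ X₃)).card =
      X₁.card * Y₁.card * Z₁.card + X₂.card * Y₂.card * Z₂.card + X₃.card * Y₃.card * Z₃.card := by
  rw [triangleSet_blockPairs₃_eq hY₁₂ hY₁₃ hY₂₃]
  have hd : ∀ {X Y Z X' Y' Z' : Finset G}, Disjoint Y Y' → Disjoint (X ×ˢ Y ×ˢ Z) (X' ×ˢ Y' ×ˢ Z') := by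
    intro X Y Z X' Y' Z' h
    rw [Finset.disjoint_left]
    rintro ⟨i, j, k⟩ h1 h2
    rw [Finset.mem_product, Finset.mem_product] at h1 h2
    exact Finset.disjoint_left.mp h h1.2.1 h2.2.1
  rw [Finset.card_union_of_disjoint (Finset.disjoint_union_left.mpr ⟨hd hY₁₃, hd hY₂₃⟩),
    Finset.card_union_of_disjoint (hd hY₁₂), Finset.card_product, Finset.card_product, Finset.card_product,
    Finset.card_product, Finset.card_product, Finset.card_product, Nat.mul_assoc, Nat.mul_assoc, Nat.mul_assoc]

omit [AddCommGroup G] in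
/-- Two subsets of `X` meeting in `C`: `|A| + |B| ≤ |X| + |C|`. -/
theorem card_add_card_le_of_subset_of_inter_eq {A B X C : Finset G} (hA : A ⊆ X) (hB : B ⊆ X)
    (hC : A ∩ B = C) : A.card + B.card ≤ X.card + C.card := by
  have h := Finset.card_union_add_card_inter A B
  have hs : (A ∪ B).card ≤ X.card := Finset.card_le_card (Finset.union_subset hA hB)
  rw [hC] at h
  omega

omit [AddCommGroup G] in
/-- Inclusion–exclusion for three row classes, in additive form. -/
theorem card_union₃_add (X₁ X₂ X₃ : Finset G) :
    (X₁ ∪ X₂ ∪ X₃).card + (X₁ ∩ X₂).card + (X₁ ∩ X₃).card + (X₂ ∩ X₃).card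
      = X₁.card + X₂.card + X₃.card + (X₁ ∩ X₂ ∩ X₃).card := by
  have h1 := Finset.card_union_add_card_inter X₁ X₂
  have h2 := Finset.card_union_add_card_inter (X₁ ∪ X₂) X₃
  have h3 := Finset.card_union_add_card_inter (X₁ ∩ X₃) (X₂ ∩ X₃)
  have e1 : (X₁ ∪ X₂) ∩ X₃ = X₁ ∩ X₃ ∪ X₂ ∩ X₃ := by
    ext g
    simp only [Finset.mem_inter, Finset.mem_union]
    tauto
  have e2 : X₁ ∩ X₃ ∩ (X₂ ∩ X₃) = X₁ ∩ X₂ ∩ X₃ := by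
    ext g
    simp only [Finset.mem_inter]
    tauto
  rw [e1] at h2
  rw [e2] at h3
  omega

/-- THE NORMALISED THREE-BLOCK BOUND.  For an accidental-free union of three complete blocks with pairwise
disjoint `J`-classes and pairwise disjoint `K`-classes (rows arbitrary), the number `T` of supported triangles
satisfies `T³ ≤ |G|² · |X₁ ∪ X₂ ∪ X₃| · |Y₁ ∪ Y₂ ∪ Y₃| · |Z₁ ∪ Z₂ ∪ Z₃|`. -/
theorem NoAccidental.card_triangleSet₃_pow_three_le [Fintype G] (hY₁₂ : Disjoint Y₁ Y₂)
    (hY₁₃ : Disjoint Y₁ Y₃) (hY₂₃ : Disjoint Y₂ Y₃) (hZ₁₂ : Disjoint Z₁ Z₂) (hZ₁₃ : Disjoint Z₁ Z₃)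
    (hZ₂₃ : Disjoint Z₂ Z₃)
    (hN : NoAccidental (id : G → G) id id (blockPairs₃ X₁ Y₁ X₂ Y₂ X₃ Y₃) (blockPairs₃ Y₁ Z₁ Y₂ Z₂ Y₃ Z₃)
      (blockPairs₃ Z₁ X₁ Z₂ X₂ Z₃ X₃)) :
    (triangleSet (blockPairs₃ X₁ Y₁ X₂ Y₂ X₃ Y₃) (blockPairs₃ Y₁ Z₁ Y₂ Z₂ Y₃ Z₃)
        (blockPairs₃ Z₁ X₁ Z₂ X₂ Z₃ X₃)).card ^ 3
      ≤ Fintype.card G ^ 2 * (X₁ ∪ X₂ ∪ X₃).card * (Y₁ ∪ Y₂ ∪ Y₃).card * (Z₁ ∪ Z₂ ∪ Z₃).card := by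
  have h12 := hN.sub₁₂
  have h13 := hN.sub₁₃
  have h23 := hN.sub₂₃
  have c1 : X₁ ∩ X₂ ∩ X₃ ⊆ X₁ := Finset.inter_subset_left.trans Finset.inter_subset_left
  have c2 : X₁ ∩ X₂ ∩ X₃ ⊆ X₂ := Finset.inter_subset_left.trans Finset.inter_subset_right
  have c3 : X₁ ∩ X₂ ∩ X₃ ⊆ X₃ := Finset.inter_subset_right
  -- the six transitive sink inequalities (sink t, middle u, top s)
  have s12 := NoAccidental.sink_ineq h12 h13 h23 hY₁₂ hY₁₃ hY₂₃ Finset.inter_subset_left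
    Finset.inter_subset_right c1 c2 c3
  have s13 := NoAccidental.sink_ineq h13 h12 h23.swap_blocks hY₁₃ hY₁₂ hY₂₃.symm Finset.inter_subset_left
    Finset.inter_subset_right c1 c3 c2
  have s21 := NoAccidental.sink_ineq h12.swap_blocks h23 h13 hY₁₂.symm hY₂₃ hY₁₃ Finset.inter_subset_right
    Finset.inter_subset_left c2 c1 c3
  have s23 := NoAccidental.sink_ineq h23 h12.swap_blocks h13.swap_blocks hY₂₃ hY₁₂.symm hY₁₃.symm
    Finset.inter_subset_left Finset.inter_subset_right c2 c3 c1
  have s31 := NoAccidental.sink_ineq h13.swap_blocks h23.swap_blocks h12 hY₁₃.symm hY₂₃.symm hY₁₂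
    Finset.inter_subset_right Finset.inter_subset_left c3 c1 c2
  have s32 := NoAccidental.sink_ineq h23.swap_blocks h13.swap_blocks h12.swap_blocks hY₂₃.symm hY₁₃.symm
    hY₁₂.symm Finset.inter_subset_right Finset.inter_subset_left c3 c2 c1
  have e12 : X₁ ∩ X₂ ∩ (X₁ ∩ X₃) = X₁ ∩ X₂ ∩ X₃ := by
    ext g
    simp only [Finset.mem_inter]
    tauto
  have e13 : X₁ ∩ X₂ ∩ (X₂ ∩ X₃) = X₁ ∩ X₂ ∩ X₃ := by
    ext g
    simp only [Finset.mem_inter]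
    tauto
  have e23 : X₁ ∩ X₃ ∩ (X₂ ∩ X₃) = X₁ ∩ X₂ ∩ X₃ := by
    ext g
    simp only [Finset.mem_inter]
    tauto
  have hJ : (Y₁ ∪ Y₂ ∪ Y₃).card = Y₁.card + Y₂.card + Y₃.card := by
    rw [Finset.card_union_of_disjoint (Finset.disjoint_union_left.mpr ⟨hY₁₃, hY₂₃⟩),
      Finset.card_union_of_disjoint hY₁₂]
  have hK : (Z₁ ∪ Z₂ ∪ Z₃).card = Z₁.card + Z₂.card + Z₃.card := by
    rw [Finset.card_union_of_disjoint (Finset.disjoint_union_left.mpr ⟨hZ₁₃, hZ₂₃⟩),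
      Finset.card_union_of_disjoint hZ₁₂]
  rw [card_triangleSet_blockPairs₃ hY₁₂ hY₁₃ hY₂₃, hJ, hK]
  exact cube_le_of_overlaps₃ s12 s13 s21 s23 s31 s32 (Finset.card_le_card Finset.inter_subset_left)
    (Finset.card_le_card (Finset.subset_inter c1 c3)) (Finset.card_le_card (Finset.subset_inter c2 c3))
    (card_add_card_le_of_subset_of_inter_eq Finset.inter_subset_left Finset.inter_subset_left e12)
    (card_add_card_le_of_subset_of_inter_eq Finset.inter_subset_right Finset.inter_subset_left e13)
    (card_add_card_le_of_subset_of_inter_eq Finset.inter_subset_right Finset.inter_subset_right e23)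
    (card_union₃_add X₁ X₂ X₃)

end ThreeBlocks

end Summit.MatrixMultiplication.MatrixMultiplication.Theorems.SoloVal
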